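import Summits.Ventures.PercRepro.Night2LocalDGenS

/-!
# PercRepro — THE FIVE `(7, 5)` CELLS IN THEIR TWO-PARAMETER SPREAD REGIMES (night-2, gen 19)

`localShadowHall_dgenS_of_sum` with the pairs `(m₂, m₁)` — basis members miss `≥ m₂` points, non-basis members
`≥ m₁` — at `q = 5`: `(3, 0)`: `(3, 2)` (`c′ = 1/15`, `λ₂ = 1/36`, `5 C(n,6) ≤ 2A + 30T`, `n ≥ 9`); `(3, 1)`: `(5, 2)`
(`c′ = 1/120`, `λ₂ = 1/240`, `5 C(n,5) ≤ 2A + 240T`, `n ≥ 8`); `(3, 2)`: `(4, 3)` (`c′ = 1/36`, `λ₂ = 1/16`,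
`9 C(n,4) ≤ A + 36T`, `n ≥ 7`); `(2, 1)`: `(4, 4)` (`c′ = 1/36`, `λ₂ = 13/180`, `13 C(n,5) ≤ A + 36T`, `n ≥ 9`);
`(2, 0)`: `(4, 3)` (`c′ = 1/15`, `λ₂ = 1/36`, `5 C(n,6) ≤ 2A + 30T`, `n ≥ 10`).  Each inequality: bounded range by kernel
evaluation through `Σ_{i≤ρ} C(n,i) + A + T = 2^n`, large `n` from two middle binomials.  With `m₁ = 2` the
hypothesis on the non-basis members is void, so `(3, 0)` and `(3, 1)` need only «every basis member misses `≥ 3` /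
`≥ 5` points».  Theorems `localShadowHall_<cell>_five_of_spread2`.
-/

namespace PercRepro.Shadow

open Finset PerFlat ThmH

namespace DGenS

/-! ## The cell `(3, 0)` with `(m₂, m₁) = (3, 2)` -/

/-- `c′` at `(3, 0)`, `m₁ = 2`. -/
theorem cPrimeDGP_three_zero_s : cPrimeDGP 5 3 6 0 2 = 1 / 15 := by
  unfold cPrimeDGP capDG reqDGP phiQ; norm_num

/-- `λ₂` at `(3, 0)`, `m₂ = 3`. -/
theorem lambdaDGS_three_zero : lambdaDGS 5 3 6 0 3 = 1 / 36 := by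
  unfold lambdaDGS capDG reqDGP phiQ; norm_num

/-- The growth bound of the cell `(3, 0)` for `n ≥ 15`. -/
theorem three_zero_growth_s {n : ℕ} (hn : 15 ≤ n) : 5 * n.choose 6 ≤ 2 * (n.choose 7 + n.choose 8) := by
  obtain ⟨m, rfl⟩ : ∃ m, n = m + 15 := ⟨n - 15, by omega⟩
  have h7 := Nat.choose_succ_right_eq (m + 15) 6
  have h8 := Nat.choose_succ_right_eq (m + 15) 7
  rw [show m + 15 - 6 = m + 9 by omega] at h7
  rw [show m + 15 - 7 = m + 8 by omega] at h8
  have l1 : 9 * (m + 15).choose 6 ≤ 7 * (m + 15).choose 7 := by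
    nlinarith [h7, Nat.zero_le ((m + 15).choose 6 * m)]
  have l2 : 8 * (m + 15).choose 7 ≤ 8 * (m + 15).choose 8 := by
    nlinarith [h8, Nat.zero_le ((m + 15).choose 7 * m)]
  omega

/-- The bounded range of the cell `(3, 0)`. -/
theorem three_zero_sineq_small {n : ℕ} (hn : 9 ≤ n) (hn' : n ≤ 14) :
    5 * n.choose 6 ≤ 2 * DGen.Aρt n 6 3 + 30 * DGen.Ttop n 3 := by
  have hid : (∑ i ∈ Finset.range 7, n.choose i) + DGen.Aρt n 6 3 + DGen.Ttop n 3 = 2 ^ n :=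
    DGen.sum_range_add_Aρt_add_Ttop (by omega)
  have key : 5 * n.choose 6 + 2 * (∑ i ∈ Finset.range 7, n.choose i) ≤ 2 * 2 ^ n + 28 * DGen.Ttop n 3 := by
    unfold DGen.Ttop
    interval_cases n <;> decide
  omega

/-- **The cell `(3, 0)` inequality** for every `n ≥ 9`. -/
theorem three_zero_sineq {n : ℕ} (hn : 9 ≤ n) : 5 * n.choose 6 ≤ 2 * DGen.Aρt n 6 3 + 30 * DGen.Ttop n 3 := by
  by_cases h : n ≤ 14
  · exact three_zero_sineq_small hn h
  · push Not at h
    have hA : n.choose 7 + n.choose 8 ≤ DGen.Aρt n 6 3 := DGen.Aρt_ge_two (by omega)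
    have h2 := three_zero_growth_s (by omega : 15 ≤ n)
    omega

/-- The target sum of the cell `(3, 0)` is at least `1` for every `n ≥ 9`. -/
theorem one_le_genSum_three_zero_s {n : ℕ} (hn : 9 ≤ n) :
    1 ≤ DGenP.genSum n 6 3 (cPrimeDGP 5 3 6 0 2) (lambdaDGS 5 3 6 0 3) := by
  rw [cPrimeDGP_three_zero_s, lambdaDGS_three_zero, DGenP.genSum_eq (by omega) (by norm_num) (by norm_num)]
  have hC : (0 : ℚ) < (n.choose 6 : ℚ) := by exact_mod_cast Nat.choose_pos (by omega)
  rw [le_div_iff₀ (by positivity)]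
  have key' : (5 : ℚ) * (n.choose 6 : ℚ) ≤ 2 * (DGen.Aρt n 6 3 : ℚ) + 30 * (DGen.Ttop n 3 : ℚ) := by
    exact_mod_cast three_zero_sineq hn
  norm_num
  linarith

/-! ## The cell `(3, 1)` with `(m₂, m₁) = (5, 2)` -/

/-- `c′` at `(3, 1)`, `m₁ = 2`. -/
theorem cPrimeDGP_three_one_s : cPrimeDGP 5 3 5 1 2 = 1 / 120 := by
  unfold cPrimeDGP capDG reqDGP phiQ; norm_num

/-- `λ₂` at `(3, 1)`, `m₂ = 5`. -/
theorem lambdaDGS_three_one : lambdaDGS 5 3 5 1 5 = 1 / 240 := by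
  unfold lambdaDGS capDG reqDGP phiQ; norm_num

/-- The growth bound of the cell `(3, 1)` for `n ≥ 13`. -/
theorem three_one_growth_s {n : ℕ} (hn : 13 ≤ n) : 5 * n.choose 5 ≤ 2 * (n.choose 6 + n.choose 7) := by
  obtain ⟨m, rfl⟩ : ∃ m, n = m + 13 := ⟨n - 13, by omega⟩
  have h6 := Nat.choose_succ_right_eq (m + 13) 5
  have h7 := Nat.choose_succ_right_eq (m + 13) 6
  rw [show m + 13 - 5 = m + 8 by omega] at h6
  rw [show m + 13 - 6 = m + 7 by omega] at h7
  have l1 : 8 * (m + 13).choose 5 ≤ 6 * (m + 13).choose 6 := by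
    nlinarith [h6, Nat.zero_le ((m + 13).choose 5 * m)]
  have l2 : 7 * (m + 13).choose 6 ≤ 7 * (m + 13).choose 7 := by
    nlinarith [h7, Nat.zero_le ((m + 13).choose 6 * m)]
  omega

/-- The bounded range of the cell `(3, 1)`. -/
theorem three_one_sineq_small {n : ℕ} (hn : 8 ≤ n) (hn' : n ≤ 12) :
    5 * n.choose 5 ≤ 2 * DGen.Aρt n 5 3 + 240 * DGen.Ttop n 3 := by
  have hid : (∑ i ∈ Finset.range 6, n.choose i) + DGen.Aρt n 5 3 + DGen.Ttop n 3 = 2 ^ n :=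
    DGen.sum_range_add_Aρt_add_Ttop (by omega)
  have key : 5 * n.choose 5 + 2 * (∑ i ∈ Finset.range 6, n.choose i) ≤ 2 * 2 ^ n + 238 * DGen.Ttop n 3 := by
    unfold DGen.Ttop
    interval_cases n <;> decide
  omega

/-- **The cell `(3, 1)` inequality** for every `n ≥ 8`. -/
theorem three_one_sineq {n : ℕ} (hn : 8 ≤ n) : 5 * n.choose 5 ≤ 2 * DGen.Aρt n 5 3 + 240 * DGen.Ttop n 3 := by
  by_cases h : n ≤ 12
  · exact three_one_sineq_small hn h
  · push Not at h
    have hA : n.choose 6 + n.choose 7 ≤ DGen.Aρt n 5 3 := DGen.Aρt_ge_two (by omega)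
    have h2 := three_one_growth_s (by omega : 13 ≤ n)
    omega

/-- The target sum of the cell `(3, 1)` is at least `1` for every `n ≥ 8`. -/
theorem one_le_genSum_three_one_s {n : ℕ} (hn : 8 ≤ n) :
    1 ≤ DGenP.genSum n 5 3 (cPrimeDGP 5 3 5 1 2) (lambdaDGS 5 3 5 1 5) := by
  rw [cPrimeDGP_three_one_s, lambdaDGS_three_one, DGenP.genSum_eq (by omega) (by norm_num) (by norm_num)]
  have hC : (0 : ℚ) < (n.choose 5 : ℚ) := by exact_mod_cast Nat.choose_pos (by omega)
  rw [le_div_iff₀ (by positivity)]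
  have key' : (5 : ℚ) * (n.choose 5 : ℚ) ≤ 2 * (DGen.Aρt n 5 3 : ℚ) + 240 * (DGen.Ttop n 3 : ℚ) := by
    exact_mod_cast three_one_sineq hn
  norm_num
  linarith

/-! ## The cell `(3, 2)` with `(m₂, m₁) = (4, 3)` -/

/-- `c′` at `(3, 2)`, `m₁ = 3`. -/
theorem cPrimeDGP_three_two_s : cPrimeDGP 5 3 4 2 3 = 1 / 36 := by
  unfold cPrimeDGP capDG reqDGP phiQ; norm_num

/-- `λ₂` at `(3, 2)`, `m₂ = 4`. -/
theorem lambdaDGS_three_two : lambdaDGS 5 3 4 2 4 = 1 / 16 := by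
  unfold lambdaDGS capDG reqDGP phiQ; norm_num

/-- The growth bound of the cell `(3, 2)` for `n ≥ 19`. -/
theorem three_two_growth_s {n : ℕ} (hn : 19 ≤ n) : 9 * n.choose 4 ≤ 1 * (n.choose 5 + n.choose 6) := by
  obtain ⟨m, rfl⟩ : ∃ m, n = m + 19 := ⟨n - 19, by omega⟩
  have h5 := Nat.choose_succ_right_eq (m + 19) 4
  have h6 := Nat.choose_succ_right_eq (m + 19) 5
  rw [show m + 19 - 4 = m + 15 by omega] at h5
  rw [show m + 19 - 5 = m + 14 by omega] at h6
  have l1 : 15 * (m + 19).choose 4 ≤ 5 * (m + 19).choose 5 := by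
    nlinarith [h5, Nat.zero_le ((m + 19).choose 4 * m)]
  have l2 : 14 * (m + 19).choose 5 ≤ 6 * (m + 19).choose 6 := by
    nlinarith [h6, Nat.zero_le ((m + 19).choose 5 * m)]
  omega

/-- The bounded range of the cell `(3, 2)`. -/
theorem three_two_sineq_small {n : ℕ} (hn : 7 ≤ n) (hn' : n ≤ 18) :
    9 * n.choose 4 ≤ 1 * DGen.Aρt n 4 3 + 36 * DGen.Ttop n 3 := by
  have hid : (∑ i ∈ Finset.range 5, n.choose i) + DGen.Aρt n 4 3 + DGen.Ttop n 3 = 2 ^ n :=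
    DGen.sum_range_add_Aρt_add_Ttop (by omega)
  have key : 9 * n.choose 4 + 1 * (∑ i ∈ Finset.range 5, n.choose i) ≤ 1 * 2 ^ n + 35 * DGen.Ttop n 3 := by
    unfold DGen.Ttop
    interval_cases n <;> decide
  omega

/-- **The cell `(3, 2)` inequality** for every `n ≥ 7`. -/
theorem three_two_sineq {n : ℕ} (hn : 7 ≤ n) : 9 * n.choose 4 ≤ 1 * DGen.Aρt n 4 3 + 36 * DGen.Ttop n 3 := by
  by_cases h : n ≤ 18
  · exact three_two_sineq_small hn h
  · push Not at h
    have hA : n.choose 5 + n.choose 6 ≤ DGen.Aρt n 4 3 := DGen.Aρt_ge_two (by omega)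
    have h2 := three_two_growth_s (by omega : 19 ≤ n)
    omega

/-- The target sum of the cell `(3, 2)` is at least `1` for every `n ≥ 7`. -/
theorem one_le_genSum_three_two_s {n : ℕ} (hn : 7 ≤ n) :
    1 ≤ DGenP.genSum n 4 3 (cPrimeDGP 5 3 4 2 3) (lambdaDGS 5 3 4 2 4) := by
  rw [cPrimeDGP_three_two_s, lambdaDGS_three_two, DGenP.genSum_eq (by omega) (by norm_num) (by norm_num)]
  have hC : (0 : ℚ) < (n.choose 4 : ℚ) := by exact_mod_cast Nat.choose_pos (by omega)
  rw [le_div_iff₀ (by positivity)]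
  have key' : (9 : ℚ) * (n.choose 4 : ℚ) ≤ 1 * (DGen.Aρt n 4 3 : ℚ) + 36 * (DGen.Ttop n 3 : ℚ) := by
    exact_mod_cast three_two_sineq hn
  norm_num
  linarith

/-! ## The cell `(2, 1)` with `(m₂, m₁) = (4, 4)` -/

/-- `c′` at `(2, 1)`, `m₁ = 4`. -/
theorem cPrimeDGP_two_one_s : cPrimeDGP 5 2 5 1 4 = 1 / 36 := by
  unfold cPrimeDGP capDG reqDGP phiQ; norm_num

/-- `λ₂` at `(2, 1)`, `m₂ = 4`. -/
theorem lambdaDGS_two_one : lambdaDGS 5 2 5 1 4 = 13 / 180 := by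
  unfold lambdaDGS capDG reqDGP phiQ; norm_num

/-- The growth bound of the cell `(2, 1)` for `n ≥ 26`. -/
theorem two_one_growth_s {n : ℕ} (hn : 26 ≤ n) : 13 * n.choose 5 ≤ 1 * (n.choose 6 + n.choose 7) := by
  obtain ⟨m, rfl⟩ : ∃ m, n = m + 26 := ⟨n - 26, by omega⟩
  have h6 := Nat.choose_succ_right_eq (m + 26) 5
  have h7 := Nat.choose_succ_right_eq (m + 26) 6
  rw [show m + 26 - 5 = m + 21 by omega] at h6
  rw [show m + 26 - 6 = m + 20 by omega] at h7
  have l1 : 21 * (m + 26).choose 5 ≤ 6 * (m + 26).choose 6 := by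
    nlinarith [h6, Nat.zero_le ((m + 26).choose 5 * m)]
  have l2 : 20 * (m + 26).choose 6 ≤ 7 * (m + 26).choose 7 := by
    nlinarith [h7, Nat.zero_le ((m + 26).choose 6 * m)]
  omega

/-- The bounded range of the cell `(2, 1)`. -/
theorem two_one_sineq_small {n : ℕ} (hn : 9 ≤ n) (hn' : n ≤ 25) :
    13 * n.choose 5 ≤ 1 * DGen.Aρt n 5 4 + 36 * DGen.Ttop n 4 := by
  have hid : (∑ i ∈ Finset.range 6, n.choose i) + DGen.Aρt n 5 4 + DGen.Ttop n 4 = 2 ^ n :=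
    DGen.sum_range_add_Aρt_add_Ttop (by omega)
  have key : 13 * n.choose 5 + 1 * (∑ i ∈ Finset.range 6, n.choose i) ≤ 1 * 2 ^ n + 35 * DGen.Ttop n 4 := by
    unfold DGen.Ttop
    interval_cases n <;> decide
  omega

/-- **The cell `(2, 1)` inequality** for every `n ≥ 9`. -/
theorem two_one_sineq {n : ℕ} (hn : 9 ≤ n) : 13 * n.choose 5 ≤ 1 * DGen.Aρt n 5 4 + 36 * DGen.Ttop n 4 := by
  by_cases h : n ≤ 25
  · exact two_one_sineq_small hn h
  · push Not at h
    have hA : n.choose 6 + n.choose 7 ≤ DGen.Aρt n 5 4 := DGen.Aρt_ge_two (by omega)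
    have h2 := two_one_growth_s (by omega : 26 ≤ n)
    omega

/-- The target sum of the cell `(2, 1)` is at least `1` for every `n ≥ 9`. -/
theorem one_le_genSum_two_one_s {n : ℕ} (hn : 9 ≤ n) :
    1 ≤ DGenP.genSum n 5 4 (cPrimeDGP 5 2 5 1 4) (lambdaDGS 5 2 5 1 4) := by
  rw [cPrimeDGP_two_one_s, lambdaDGS_two_one, DGenP.genSum_eq (by omega) (by norm_num) (by norm_num)]
  have hC : (0 : ℚ) < (n.choose 5 : ℚ) := by exact_mod_cast Nat.choose_pos (by omega)
  rw [le_div_iff₀ (by positivity)]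
  have key' : (13 : ℚ) * (n.choose 5 : ℚ) ≤ 1 * (DGen.Aρt n 5 4 : ℚ) + 36 * (DGen.Ttop n 4 : ℚ) := by
    exact_mod_cast two_one_sineq hn
  norm_num
  linarith

/-! ## The cell `(2, 0)` with `(m₂, m₁) = (4, 3)` -/

/-- `c′` at `(2, 0)`, `m₁ = 3`. -/
theorem cPrimeDGP_two_zero_s : cPrimeDGP 5 2 6 0 3 = 1 / 15 := by
  unfold cPrimeDGP capDG reqDGP phiQ; norm_num

/-- `λ₂` at `(2, 0)`, `m₂ = 4`. -/
theorem lambdaDGS_two_zero : lambdaDGS 5 2 6 0 4 = 1 / 36 := by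
  unfold lambdaDGS capDG reqDGP phiQ; norm_num

/-- The growth bound of the cell `(2, 0)` for `n ≥ 15`. -/
theorem two_zero_growth_s {n : ℕ} (hn : 15 ≤ n) : 5 * n.choose 6 ≤ 2 * (n.choose 7 + n.choose 8) := by
  obtain ⟨m, rfl⟩ : ∃ m, n = m + 15 := ⟨n - 15, by omega⟩
  have h7 := Nat.choose_succ_right_eq (m + 15) 6
  have h8 := Nat.choose_succ_right_eq (m + 15) 7
  rw [show m + 15 - 6 = m + 9 by omega] at h7
  rw [show m + 15 - 7 = m + 8 by omega] at h8
  have l1 : 9 * (m + 15).choose 6 ≤ 7 * (m + 15).choose 7 := by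
    nlinarith [h7, Nat.zero_le ((m + 15).choose 6 * m)]
  have l2 : 8 * (m + 15).choose 7 ≤ 8 * (m + 15).choose 8 := by
    nlinarith [h8, Nat.zero_le ((m + 15).choose 7 * m)]
  omega

/-- The bounded range of the cell `(2, 0)`. -/
theorem two_zero_sineq_small {n : ℕ} (hn : 10 ≤ n) (hn' : n ≤ 14) :
    5 * n.choose 6 ≤ 2 * DGen.Aρt n 6 4 + 30 * DGen.Ttop n 4 := by
  have hid : (∑ i ∈ Finset.range 7, n.choose i) + DGen.Aρt n 6 4 + DGen.Ttop n 4 = 2 ^ n :=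
    DGen.sum_range_add_Aρt_add_Ttop (by omega)
  have key : 5 * n.choose 6 + 2 * (∑ i ∈ Finset.range 7, n.choose i) ≤ 2 * 2 ^ n + 28 * DGen.Ttop n 4 := by
    unfold DGen.Ttop
    interval_cases n <;> decide
  omega

/-- **The cell `(2, 0)` inequality** for every `n ≥ 10`. -/
theorem two_zero_sineq {n : ℕ} (hn : 10 ≤ n) : 5 * n.choose 6 ≤ 2 * DGen.Aρt n 6 4 + 30 * DGen.Ttop n 4 := by
  by_cases h : n ≤ 14
  · exact two_zero_sineq_small hn h
  · push Not at h
    have hA : n.choose 7 + n.choose 8 ≤ DGen.Aρt n 6 4 := DGen.Aρt_ge_two (by omega)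
    have h2 := two_zero_growth_s (by omega : 15 ≤ n)
    omega

/-- The target sum of the cell `(2, 0)` is at least `1` for every `n ≥ 10`. -/
theorem one_le_genSum_two_zero_s {n : ℕ} (hn : 10 ≤ n) :
    1 ≤ DGenP.genSum n 6 4 (cPrimeDGP 5 2 6 0 3) (lambdaDGS 5 2 6 0 4) := by
  rw [cPrimeDGP_two_zero_s, lambdaDGS_two_zero, DGenP.genSum_eq (by omega) (by norm_num) (by norm_num)]
  have hC : (0 : ℚ) < (n.choose 6 : ℚ) := by exact_mod_cast Nat.choose_pos (by omega)
  rw [le_div_iff₀ (by positivity)]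
  have key' : (5 : ℚ) * (n.choose 6 : ℚ) ≤ 2 * (DGen.Aρt n 6 4 : ℚ) + 30 * (DGen.Ttop n 4 : ℚ) := by
    exact_mod_cast two_zero_sineq hn
  norm_num
  linarith

end DGenS

variable {α : Type*} [DecidableEq α] {M : Matroid α} [M.Finite]

open scoped Classical in
/-- **THE `(7, 5)` CELL `(3, 0)` IN THE `(3, 2)`-SPREAD REGIME**: every basis member misses `≥ 3` points and
every non-basis thin member `≥ 2`. -/
theorem localShadowHall_three_zero_five_of_spread2 {G : Finset α} (hG : G ∈ flatsQ M (5 + 1))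
    (hd : (gr M \ G).card = 3) (hk : kColoops M G = 0)
    (hs : ∀ e ∈ gr M, ∀ f ∈ gr M, e ≠ f → rkN M {e, f} = 2) (hl : ∀ e ∈ gr M, M.Indep {e})
    (hm₁ : ∀ B ∈ thinMembers M 5 G, 6 ≤ (B \ coloops M G).card → 2 ≤ (G \ clF M B).card)
    (hm₂ : ∀ B ∈ thinMembers M 5 G, (B \ coloops M G).card + 1 = 6 → 3 ≤ (G \ clF M B).card) :
    LocalShadowHall M 5 G := by
  by_cases hn : 9 ≤ G.card - kColoops M G
  · exact localShadowHall_dgenS_of_sum (d := 3) (ρ := 6) (m₁ := 2) (m₂ := 3) hG hd (by norm_num) (by rw [hk])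
      (by norm_num) (by omega) hs hl (by rw [hk, DGenS.cPrimeDGP_three_zero_s]; norm_num)
      (by rw [hk, DGenS.lambdaDGS_three_zero]; norm_num) hm₁ hm₂
      (by rw [hk] at hn ⊢; exact DGenS.one_le_genSum_three_zero_s hn)
  · exact localShadowHall_of_spread (ρ := 6) (m₀ := 4) hG hd (by norm_num) (by rw [hk])
      (fun B hB => absurd (thin_card_bound (ρ := 6) hG hd (by norm_num) (by rw [hk]) hB) (by omega))
      (by rw [hk]; unfold phiQ; norm_num)

open scoped Classical in
/-- **THE `(7, 5)` CELL `(3, 1)` IN THE `(5, 2)`-SPREAD REGIME**: every basis member misses `≥ 5` points and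
every non-basis thin member `≥ 2`. -/
theorem localShadowHall_three_one_five_of_spread2 {G : Finset α} (hG : G ∈ flatsQ M (5 + 1))
    (hd : (gr M \ G).card = 3) (hk : kColoops M G = 1)
    (hs : ∀ e ∈ gr M, ∀ f ∈ gr M, e ≠ f → rkN M {e, f} = 2) (hl : ∀ e ∈ gr M, M.Indep {e})
    (hm₁ : ∀ B ∈ thinMembers M 5 G, 5 ≤ (B \ coloops M G).card → 2 ≤ (G \ clF M B).card)
    (hm₂ : ∀ B ∈ thinMembers M 5 G, (B \ coloops M G).card + 1 = 5 → 5 ≤ (G \ clF M B).card) :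
    LocalShadowHall M 5 G := by
  by_cases hn : 8 ≤ G.card - kColoops M G
  · exact localShadowHall_dgenS_of_sum (d := 3) (ρ := 5) (m₁ := 2) (m₂ := 5) hG hd (by norm_num) (by rw [hk])
      (by norm_num) (by omega) hs hl (by rw [hk, DGenS.cPrimeDGP_three_one_s]; norm_num)
      (by rw [hk, DGenS.lambdaDGS_three_one]; norm_num) hm₁ hm₂
      (by rw [hk] at hn ⊢; exact DGenS.one_le_genSum_three_one_s hn)
  · exact localShadowHall_of_spread (ρ := 5) (m₀ := 6) hG hd (by norm_num) (by rw [hk])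
      (fun B hB => absurd (thin_card_bound (ρ := 5) hG hd (by norm_num) (by rw [hk]) hB) (by omega))
      (by rw [hk]; unfold phiQ; norm_num)

open scoped Classical in
/-- **THE `(7, 5)` CELL `(3, 2)` IN THE `(4, 3)`-SPREAD REGIME**: every basis member misses `≥ 4` points and
every non-basis thin member `≥ 3`. -/
theorem localShadowHall_three_two_five_of_spread2 {G : Finset α} (hG : G ∈ flatsQ M (5 + 1))
    (hd : (gr M \ G).card = 3) (hk : kColoops M G = 2)
    (hs : ∀ e ∈ gr M, ∀ f ∈ gr M, e ≠ f → rkN M {e, f} = 2) (hl : ∀ e ∈ gr M, M.Indep {e})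
    (hm₁ : ∀ B ∈ thinMembers M 5 G, 4 ≤ (B \ coloops M G).card → 3 ≤ (G \ clF M B).card)
    (hm₂ : ∀ B ∈ thinMembers M 5 G, (B \ coloops M G).card + 1 = 4 → 4 ≤ (G \ clF M B).card) :
    LocalShadowHall M 5 G := by
  by_cases hn : 7 ≤ G.card - kColoops M G
  · exact localShadowHall_dgenS_of_sum (d := 3) (ρ := 4) (m₁ := 3) (m₂ := 4) hG hd (by norm_num) (by rw [hk])
      (by norm_num) (by omega) hs hl (by rw [hk, DGenS.cPrimeDGP_three_two_s]; norm_num)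
      (by rw [hk, DGenS.lambdaDGS_three_two]; norm_num) hm₁ hm₂
      (by rw [hk] at hn ⊢; exact DGenS.one_le_genSum_three_two_s hn)
  · exact localShadowHall_of_spread (ρ := 4) (m₀ := 9) hG hd (by norm_num) (by rw [hk])
      (fun B hB => absurd (thin_card_bound (ρ := 4) hG hd (by norm_num) (by rw [hk]) hB) (by omega))
      (by rw [hk]; unfold phiQ; norm_num)

open scoped Classical in
/-- **THE `(7, 5)` CELL `(2, 1)` IN THE `(4, 4)`-SPREAD REGIME**: every basis member misses `≥ 4` points and
every non-basis thin member `≥ 4`. -/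
theorem localShadowHall_two_one_five_of_spread2 {G : Finset α} (hG : G ∈ flatsQ M (5 + 1))
    (hd : (gr M \ G).card = 2) (hk : kColoops M G = 1)
    (hs : ∀ e ∈ gr M, ∀ f ∈ gr M, e ≠ f → rkN M {e, f} = 2) (hl : ∀ e ∈ gr M, M.Indep {e})
    (hm₁ : ∀ B ∈ thinMembers M 5 G, 5 ≤ (B \ coloops M G).card → 4 ≤ (G \ clF M B).card)
    (hm₂ : ∀ B ∈ thinMembers M 5 G, (B \ coloops M G).card + 1 = 5 → 4 ≤ (G \ clF M B).card) :
    LocalShadowHall M 5 G := by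
  by_cases hn : 9 ≤ G.card - kColoops M G
  · exact localShadowHall_dgenS_of_sum (d := 2) (ρ := 5) (m₁ := 4) (m₂ := 4) hG hd (by norm_num) (by rw [hk])
      (by norm_num) (by omega) hs hl (by rw [hk, DGenS.cPrimeDGP_two_one_s]; norm_num)
      (by rw [hk, DGenS.lambdaDGS_two_one]; norm_num) hm₁ hm₂
      (by rw [hk] at hn ⊢; exact DGenS.one_le_genSum_two_one_s hn)
  · exact localShadowHall_of_spread (ρ := 5) (m₀ := 8) hG hd (by norm_num) (by rw [hk])
      (fun B hB => absurd (thin_card_bound (ρ := 5) hG hd (by norm_num) (by rw [hk]) hB) (by omega))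
      (by rw [hk]; unfold phiQ; norm_num)

open scoped Classical in
/-- **THE `(7, 5)` CELL `(2, 0)` IN THE `(4, 3)`-SPREAD REGIME**: every basis member misses `≥ 4` points and
every non-basis thin member `≥ 3`. -/
theorem localShadowHall_two_zero_five_of_spread2 {G : Finset α} (hG : G ∈ flatsQ M (5 + 1))
    (hd : (gr M \ G).card = 2) (hk : kColoops M G = 0)
    (hs : ∀ e ∈ gr M, ∀ f ∈ gr M, e ≠ f → rkN M {e, f} = 2) (hl : ∀ e ∈ gr M, M.Indep {e})
    (hm₁ : ∀ B ∈ thinMembers M 5 G, 6 ≤ (B \ coloops M G).card → 3 ≤ (G \ clF M B).card)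
    (hm₂ : ∀ B ∈ thinMembers M 5 G, (B \ coloops M G).card + 1 = 6 → 4 ≤ (G \ clF M B).card) :
    LocalShadowHall M 5 G := by
  by_cases hn : 10 ≤ G.card - kColoops M G
  · exact localShadowHall_dgenS_of_sum (d := 2) (ρ := 6) (m₁ := 3) (m₂ := 4) hG hd (by norm_num) (by rw [hk])
      (by norm_num) (by omega) hs hl (by rw [hk, DGenS.cPrimeDGP_two_zero_s]; norm_num)
      (by rw [hk, DGenS.lambdaDGS_two_zero]; norm_num) hm₁ hm₂
      (by rw [hk] at hn ⊢; exact DGenS.one_le_genSum_two_zero_s hn)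
  · exact localShadowHall_of_spread (ρ := 6) (m₀ := 5) hG hd (by norm_num) (by rw [hk])
      (fun B hB => absurd (thin_card_bound (ρ := 6) hG hd (by norm_num) (by rw [hk]) hB) (by omega))
      (by rw [hk]; unfold phiQ; norm_num)

end PercRepro.Shadow
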